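import Mathlib
import Literature.NumberTheory.Irrationality.Fischler2002.JnFinitenessCriterionProofs
import Literature.NumberTheory.Irrationality.Fischler2002.LFinitenessUpperProofs
import HarnessLib

/-!
# The finiteness criterion for Fischler's Sorokin-type family `𝓛(P)` — II: lower bounds and the integer bookkeeping

Topic `Literature/NumberTheory/Irrationality/Fischler2002`; proofs-only companion of `BeukersSorokinChangeOfVariables.lean`
(the §2 file: `headProduct`, `integrandL`, `L`), second of three files (I: `LFinitenessUpperProofs.lean`, III:
`LFinitenessCriterionProofs.lean`). Source: S. Fischler, « Formes linéaires en polyzêtas et intégrales multiples », C. R.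
Acad. Sci. Paris Sér. I **335** (2002) 1–4 = arXiv:math/0202064 [Fischler2002Polyzetas], §2 p. 3 (`paper:arxiv-math_0202064`
p. 3): "Cette intégrale [`𝓛(P)`] est finie [si et seulement si] on a `Σ_{k=2}^{n} (C_k − B_k)⁺ ≤ B₁` et `A_k ≥ 0`, `B_k ≥ 0`
pour tout `k`" — a remark CORRECTED by the journal version [Fischler2003RhinViola, §5.2 Proposition 16, footnote 3:
« Noter l'erreur, à ce propos, dans [6] »], whose wording is not held (acq-09250); the criterion proved in file III is the
seat's own derivation (cell `pub-zeta5`, seat ct-1 g33, 2026-08-27).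

HONEST FRAMING (cells pub-zeta5 / zeta5-irr): systematic search; no irrationality claim unless certified. Real analysis
only (Tonelli and one-variable estimates for integrals of non-negative functions); nothing about `ζ(5)`.

## Contents (theorems only; no definition; no new named fact)
* `psi_conditions_of_lintegral_lt_top` — «only if» through the peeling: with the EXACT exponents
  `r_k = (γ_k + r_{k+1} − β_k − 1)⁺` finiteness of `∫Ψ_m` forces `α_k > −1`, `β_k > −1` (`k ≥ 2`), `β₁ − γ₁ − r₂ > −1`
  (divergence of the Euler kernel on every fibre, resp. its uniform lower bound — seat ct-1 g32's
  `EulerKernelLowerBoundsProofs.lean`, with `δ = Π_{m−1} = X₁⋯X_{m−1}`).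
* The integer bookkeeping, on a free function symbol `T` with its defining equation (a `Finset.max'`): the nested recursion
  `T_{n+1} = 0`, `T_k = (T_{k+1} + d_k)⁺` UNROLLS to `T_k = max(0, max_{k ≤ j ≤ n} Σ_{i=k}^{j} d_i)` (`maxPartialSum_rec`,
  `maxPartialSum_le_iff`, `maxPartialSum_of_lt`).
* `L_le_lintegral_psi` — `𝓛(P) ≤ ∫_{(0,1)^n}Ψ_n` (`r_{n+1} ≥ 0`), with equality for `r_{n+1} = 0`.
-/

noncomputable section

namespace Literature.NumberTheory.Irrationality.Fischler2002

open MeasureTheory Set Finset JnChi KL JnFinite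
open scoped ENNReal

namespace LFinite

/-! ### «Only if» through the peeling -/

/-- **The conditions forced by finiteness.** For real exponent functions with `r_k = (γ_k + r_{k+1} − β_k − 1)⁺`
(`2 ≤ k ≤ n`): if `∫_{(0,1)^m} Ψ_m < ∞` (`1 ≤ m ≤ n`) then `α_k > −1` (`1 ≤ k ≤ m`), `β_k > −1` (`2 ≤ k ≤ m`) and
`β₁ − γ₁ − r₂ > −1` — induction on `m`: the last variable's Euler kernel (`δ = Π_{m−1}`) diverges on every fibre unless
the two top conditions hold, and otherwise is bounded below by `c·(1 − Π_{m−1})^{−r_m}`, giving `c·∫Ψ_{m−1} ≤ ∫Ψ_m`.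
[cite: Fischler2002Polyzetas, §2 p. 3 (critère de finitude de 𝓛)] -/
theorem psi_conditions_of_lintegral_lt_top (n : ℕ) (α β γ r : ℕ → ℝ)
    (hρ : ∀ k, 2 ≤ k → k ≤ n → r k = max (γ k + r (k + 1) - β k - 1) 0) :
    ∀ m, 1 ≤ m → m ≤ n →
      ∫⁻ X in (Set.pi Set.univ fun _ : Fin m => Ioo (0 : ℝ) 1),
        ENNReal.ofReal ((∏ k ∈ Finset.Icc 1 m, coord X k ^ α k * (1 - coord X k) ^ β k * (1 - headProduct X k) ^ (-γ k)) *
          (1 - headProduct X m) ^ (-r (m + 1))) < ∞ →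
      (∀ k, 1 ≤ k → k ≤ m → -1 < α k) ∧ (∀ k, 2 ≤ k → k ≤ m → -1 < β k) ∧ -1 < β 1 - γ 1 - r 2 := by
  intro m hm hmn
  induction m with
  | zero => omega
  | succ m ih =>
    intro hfin
    rcases Nat.eq_zero_or_pos m with rfl | hmpos
    · -- one variable: a Beta integral, finite iff both exponents exceed `−1`
      rw [lintegral_openCube_succ _ (measurable_psi α β γ r (0 + 1)).ennreal_ofReal] at hfin
      have hinner : ∀ X' : Fin 0 → ℝ,
          ∫⁻ t in Ioo (0 : ℝ) 1, ENNReal.ofReal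
            ((∏ k ∈ Finset.Icc 1 (0 + 1), coord (Fin.snoc X' t : Fin (0 + 1) → ℝ) k ^ α k *
                (1 - coord (Fin.snoc X' t : Fin (0 + 1) → ℝ) k) ^ β k *
                (1 - headProduct (Fin.snoc X' t : Fin (0 + 1) → ℝ) k) ^ (-γ k)) *
              (1 - headProduct (Fin.snoc X' t : Fin (0 + 1) → ℝ) (0 + 1)) ^ (-r (0 + 1 + 1))) =
            ∫⁻ t in Ioo (0 : ℝ) 1, ENNReal.ofReal
              (t ^ α 1 * (1 - t) ^ (β 1 - γ 1 - r 2) * (1 - t * 0) ^ (-(0 : ℝ))) := by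
        intro X'
        refine setLIntegral_congr_fun measurableSet_Ioo fun t ht => ?_
        rw [psi_one α β γ r X' ht, mul_zero, sub_zero, neg_zero, Real.rpow_zero, mul_one]
      simp only [hinner] at hfin
      rw [setLIntegral_const, volume_openCube, mul_one] at hfin
      have hA : -1 < α 1 := by
        by_contra h
        rw [not_lt] at h
        rw [lintegral_eulerKernel_eq_top_of_le_left h _ _ le_rfl zero_lt_one] at hfin
        exact lt_irrefl _ hfin
      have hB : -1 < β 1 - γ 1 - r 2 := by
        by_contra h
        rw [not_lt] at h
        rw [lintegral_eulerKernel_eq_top_of_le_right _ h _ le_rfl zero_lt_one] at hfin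
        exact lt_irrefl _ hfin
      refine ⟨fun k hk1 hk2 => ?_, fun k hk1 hk2 => by omega, hB⟩
      obtain rfl : k = 1 := by omega
      exact hA
    · -- peel the last variable
      rw [lintegral_openCube_succ _ (measurable_psi α β γ r (m + 1)).ennreal_ofReal] at hfin
      -- the fibre integrals
      have hfibre : ∀ X' ∈ (Set.pi Set.univ fun _ : Fin m => Ioo (0 : ℝ) 1),
          ∫⁻ t in Ioo (0 : ℝ) 1, ENNReal.ofReal
            ((∏ k ∈ Finset.Icc 1 (m + 1), coord (Fin.snoc X' t : Fin (m + 1) → ℝ) k ^ α k *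
                (1 - coord (Fin.snoc X' t : Fin (m + 1) → ℝ) k) ^ β k *
                (1 - headProduct (Fin.snoc X' t : Fin (m + 1) → ℝ) k) ^ (-γ k)) *
              (1 - headProduct (Fin.snoc X' t : Fin (m + 1) → ℝ) (m + 1)) ^ (-r (m + 1 + 1))) =
            ENNReal.ofReal (∏ k ∈ Finset.Icc 1 m, coord X' k ^ α k * (1 - coord X' k) ^ β k *
                (1 - headProduct X' k) ^ (-γ k)) *
              ∫⁻ t in Ioo (0 : ℝ) 1, ENNReal.ofReal (t ^ α (m + 1) * (1 - t) ^ β (m + 1) *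
                (1 - t * headProduct X' m) ^ (-(γ (m + 1) + r (m + 2)))) := by
        intro X' hX'
        have hX := mem_openCube_iff.1 hX'
        rw [← lintegral_const_mul' _ _ ENNReal.ofReal_ne_top]
        refine setLIntegral_congr_fun measurableSet_Ioo fun t ht => ?_
        rw [psi_snoc α β γ r hX ht, ENNReal.ofReal_mul (psiProd_pos α β γ hX).le]
      -- the two top conditions, by divergence on every fibre
      have hA : -1 < α (m + 1) := by
        by_contra h
        rw [not_lt] at h
        refine absurd hfin (not_lt.2 (setLIntegral_openCube_eq_top fun X' hX' => ?_).ge)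
        have hX := mem_openCube_iff.1 hX'
        obtain ⟨hP0, -, hP1⟩ := headProduct_mem hX m le_rfl
        rw [hfibre X' hX', lintegral_eulerKernel_eq_top_of_le_left h _ _ hP0.le (hP1 hmpos), ENNReal.mul_top]
        rw [ne_eq, ENNReal.ofReal_eq_zero, not_le]
        exact psiProd_pos α β γ hX
      have hB : -1 < β (m + 1) := by
        by_contra h
        rw [not_lt] at h
        refine absurd hfin (not_lt.2 (setLIntegral_openCube_eq_top fun X' hX' => ?_).ge)
        have hX := mem_openCube_iff.1 hX'
        obtain ⟨hP0, -, hP1⟩ := headProduct_mem hX m le_rfl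
        rw [hfibre X' hX', lintegral_eulerKernel_eq_top_of_le_right _ h _ hP0.le (hP1 hmpos), ENNReal.mul_top]
        rw [ne_eq, ENNReal.ofReal_eq_zero, not_le]
        exact psiProd_pos α β γ hX
      -- the lower bound on every fibre: `∫ Ψ_{m+1} ≥ c · ∫ Ψ_m`
      obtain ⟨c, hc, hcb⟩ := le_lintegral_eulerKernel (α (m + 1)) (γ (m + 1) + r (m + 2)) hB
      have hexp : max (γ (m + 1) + r (m + 2) - β (m + 1) - 1) 0 = r (m + 1) := by
        rw [hρ (m + 1) (by omega) hmn]
      have hlow : ENNReal.ofReal c * ∫⁻ X' in (Set.pi Set.univ fun _ : Fin m => Ioo (0 : ℝ) 1),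
          ENNReal.ofReal ((∏ k ∈ Finset.Icc 1 m, coord X' k ^ α k * (1 - coord X' k) ^ β k *
              (1 - headProduct X' k) ^ (-γ k)) * (1 - headProduct X' m) ^ (-r (m + 1))) < ∞ := by
        rw [← lintegral_const_mul' _ _ ENNReal.ofReal_ne_top]
        refine lt_of_le_of_lt (setLIntegral_mono' (measurableSet_openCube m) fun X' hX' => ?_) hfin
        have hX := mem_openCube_iff.1 hX'
        obtain ⟨hP0, -, hP1⟩ := headProduct_mem hX m le_rfl
        have hG0 : 0 ≤ ∏ k ∈ Finset.Icc 1 m, coord X' k ^ α k * (1 - coord X' k) ^ β k *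
            (1 - headProduct X' k) ^ (-γ k) := (psiProd_pos α β γ hX).le
        have hk := hcb (headProduct X' m) hP0.le (hP1 hmpos)
        rw [hexp] at hk
        rw [hfibre X' hX']
        calc ENNReal.ofReal c * ENNReal.ofReal
              ((∏ k ∈ Finset.Icc 1 m, coord X' k ^ α k * (1 - coord X' k) ^ β k * (1 - headProduct X' k) ^ (-γ k)) *
                (1 - headProduct X' m) ^ (-r (m + 1)))
            = ENNReal.ofReal (∏ k ∈ Finset.Icc 1 m, coord X' k ^ α k * (1 - coord X' k) ^ β k *
                (1 - headProduct X' k) ^ (-γ k)) * ENNReal.ofReal (c * (1 - headProduct X' m) ^ (-r (m + 1))) := by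
              rw [← ENNReal.ofReal_mul hc.le, ← ENNReal.ofReal_mul hG0]
              ring_nf
          _ ≤ _ := mul_le_mul' le_rfl hk
      have hfin' : ∫⁻ X' in (Set.pi Set.univ fun _ : Fin m => Ioo (0 : ℝ) 1),
          ENNReal.ofReal ((∏ k ∈ Finset.Icc 1 m, coord X' k ^ α k * (1 - coord X' k) ^ β k *
              (1 - headProduct X' k) ^ (-γ k)) * (1 - headProduct X' m) ^ (-r (m + 1))) < ∞ := by
        by_contra h
        rw [not_lt, top_le_iff] at h
        rw [h, ENNReal.mul_top (by rwa [ne_eq, ENNReal.ofReal_eq_zero, not_le])] at hlow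
        exact lt_irrefl _ hlow
      obtain ⟨h1, h2, h3⟩ := ih hmpos (by omega) hfin'
      refine ⟨fun k hk1 hk2 => ?_, fun k hk1 hk2 => ?_, h3⟩
      · rcases Nat.lt_or_ge k (m + 1) with hk | hk
        · exact h1 k hk1 (by omega)
        · obtain rfl : k = m + 1 := le_antisymm hk2 hk
          exact hA
      · rcases Nat.lt_or_ge k (m + 1) with hk | hk
        · exact h2 k hk1 (by omega)
        · obtain rfl : k = m + 1 := le_antisymm hk2 hk
          exact hB

/-! ### The integer bookkeeping: maxima of partial sums -/

/-- `Σ_{i=k}^{j} d_i = d_k + Σ_{i=k+1}^{j} d_i` for `k ≤ j`. [cite: Fischler2002Polyzetas, §2 p. 3 (critère de finitude de 𝓛)] -/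
theorem sum_Icc_eq_add {d : ℕ → ℤ} {k j : ℕ} (hkj : k ≤ j) :
    ∑ i ∈ Finset.Icc k j, d i = d k + ∑ i ∈ Finset.Icc (k + 1) j, d i := by
  rw [← Finset.Ico_add_one_right_eq_Icc, Finset.sum_eq_sum_Ico_succ_bot (by omega),
    Finset.Ico_add_one_right_eq_Icc]

/-- The maximum `T_k = max(0, max_{k ≤ j ≤ n} Σ_{i=k}^{j} d_i)` dominates `0` and every partial sum.
[cite: Fischler2002Polyzetas, §2 p. 3 (critère de finitude de 𝓛)] -/
theorem maxPartialSum_ge {n : ℕ} {d : ℕ → ℤ} {T : ℕ → ℤ}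
    (hT : ∀ k, T k = (insert (0 : ℤ) ((Finset.Icc k n).image fun j => ∑ i ∈ Finset.Icc k j, d i)).max'
      (Finset.insert_nonempty _ _)) (k : ℕ) :
    0 ≤ T k ∧ ∀ j, k ≤ j → j ≤ n → ∑ i ∈ Finset.Icc k j, d i ≤ T k := by
  refine ⟨?_, fun j hkj hjn => ?_⟩
  · rw [hT k]; exact Finset.le_max' _ _ (Finset.mem_insert_self _ _)
  · rw [hT k]
    exact Finset.le_max' _ _ (Finset.mem_insert_of_mem
      (Finset.mem_image_of_mem (fun j => ∑ i ∈ Finset.Icc k j, d i) (Finset.mem_Icc.2 ⟨hkj, hjn⟩)))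

/-- `T_k ≤ b` iff `0 ≤ b` and every partial sum `Σ_{i=k}^{j} d_i ≤ b` (`k ≤ j ≤ n`).
[cite: Fischler2002Polyzetas, §2 p. 3 (critère de finitude de 𝓛)] -/
theorem maxPartialSum_le_iff {n : ℕ} {d : ℕ → ℤ} {T : ℕ → ℤ}
    (hT : ∀ k, T k = (insert (0 : ℤ) ((Finset.Icc k n).image fun j => ∑ i ∈ Finset.Icc k j, d i)).max'
      (Finset.insert_nonempty _ _)) (k : ℕ) (b : ℤ) :
    T k ≤ b ↔ 0 ≤ b ∧ ∀ j, k ≤ j → j ≤ n → ∑ i ∈ Finset.Icc k j, d i ≤ b := by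
  constructor
  · intro h
    obtain ⟨h0, hs⟩ := maxPartialSum_ge hT k
    exact ⟨h0.trans h, fun j hkj hjn => (hs j hkj hjn).trans h⟩
  · rintro ⟨h0, hs⟩
    rw [hT k]
    refine Finset.max'_le _ _ _ fun x hx => ?_
    rcases Finset.mem_insert.1 hx with rfl | hx
    · exact h0
    · obtain ⟨j, hj, rfl⟩ := Finset.mem_image.1 hx
      exact hs j (Finset.mem_Icc.1 hj).1 (Finset.mem_Icc.1 hj).2

/-- `T_k = 0` for `k > n` (no partial sum). [cite: Fischler2002Polyzetas, §2 p. 3 (critère de finitude de 𝓛)] -/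
theorem maxPartialSum_of_lt {n : ℕ} {d : ℕ → ℤ} {T : ℕ → ℤ}
    (hT : ∀ k, T k = (insert (0 : ℤ) ((Finset.Icc k n).image fun j => ∑ i ∈ Finset.Icc k j, d i)).max'
      (Finset.insert_nonempty _ _)) {k : ℕ} (hk : n < k) : T k = 0 := by
  refine le_antisymm ((maxPartialSum_le_iff hT k 0).2 ⟨le_rfl, fun j hkj hjn => by omega⟩) (maxPartialSum_ge hT k).1

/-- **The recursion, unrolled**: `T_k = (T_{k+1} + d_k)⁺` for `k ≤ n`.
[cite: Fischler2002Polyzetas, §2 p. 3 (critère de finitude de 𝓛)] -/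
theorem maxPartialSum_rec {n : ℕ} {d : ℕ → ℤ} {T : ℕ → ℤ}
    (hT : ∀ k, T k = (insert (0 : ℤ) ((Finset.Icc k n).image fun j => ∑ i ∈ Finset.Icc k j, d i)).max'
      (Finset.insert_nonempty _ _)) {k : ℕ} (hk : k ≤ n) : T k = max (T (k + 1) + d k) 0 := by
  obtain ⟨h0, hs⟩ := maxPartialSum_ge hT k
  obtain ⟨h0', hs'⟩ := maxPartialSum_ge hT (k + 1)
  refine le_antisymm ?_ (max_le ?_ h0)
  · -- `T_k ≤ (T_{k+1} + d_k)⁺`: every partial sum from `k` is `d_k` plus a partial sum from `k+1` (or `d_k` itself)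
    refine (maxPartialSum_le_iff hT k _).2 ⟨le_max_right _ _, fun j hkj hjn => ?_⟩
    refine le_trans ?_ (le_max_left _ _)
    rw [sum_Icc_eq_add hkj]
    rcases Nat.lt_or_ge j (k + 1) with hj | hj
    · rw [Finset.Icc_eq_empty (by omega), Finset.sum_empty]; linarith
    · linarith [hs' j hj hjn]
  · -- `T_{k+1} + d_k ≤ T_k`: `T_{k+1}` is `0` or a partial sum from `k+1`
    have hmem : T (k + 1) ∈ insert (0 : ℤ) ((Finset.Icc (k + 1) n).image fun j => ∑ i ∈ Finset.Icc (k + 1) j, d i) := by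
      rw [hT (k + 1)]; exact Finset.max'_mem _ _
    rcases Finset.mem_insert.1 hmem with h | h
    · rw [h, zero_add]
      have := hs k le_rfl hk
      rwa [Finset.Icc_self, Finset.sum_singleton] at this
    · obtain ⟨j, hj, hjT⟩ := Finset.mem_image.1 h
      have hj' := Finset.mem_Icc.1 hj
      have := hs j (by omega) hj'.2
      rw [sum_Icc_eq_add (by omega : k ≤ j), hjT] at this
      linarith

/-! ### `𝓛(P)` as the integral of `Ψ_n` over the open cube -/

/-- For `n ≥ 1`: `𝓛(P) = ∫_{(0,1)^n} Ψ_n` with `α = A`, `β = B`, `γ₁ = 0`, `γ_k = C_k + 1`, provided `r_{n+1} = 0`; and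
`𝓛(P) ≤ ∫_{(0,1)^n} Ψ_n` whenever `r_{n+1} ≥ 0`. [cite: Fischler2002Polyzetas, §2 p. 3 (definition of 𝓛(P))] -/
theorem L_le_lintegral_psi {n : ℕ} (hn : 1 ≤ n) (P : Exponents) (r : ℕ → ℝ) (hr : 0 ≤ r (n + 1)) :
    L n P ≤ ∫⁻ X in (Set.pi Set.univ fun _ : Fin n => Ioo (0 : ℝ) 1),
        ENNReal.ofReal ((∏ k ∈ Finset.Icc 1 n, coord X k ^ (P.a k : ℝ) * (1 - coord X k) ^ (P.b k : ℝ) *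
            (1 - headProduct X k) ^ (-(if k = 1 then (0 : ℝ) else ((P.c k : ℝ) + 1)))) *
          (1 - headProduct X n) ^ (-r (n + 1))) ∧
    (r (n + 1) = 0 → L n P = ∫⁻ X in (Set.pi Set.univ fun _ : Fin n => Ioo (0 : ℝ) 1),
        ENNReal.ofReal ((∏ k ∈ Finset.Icc 1 n, coord X k ^ (P.a k : ℝ) * (1 - coord X k) ^ (P.b k : ℝ) *
            (1 - headProduct X k) ^ (-(if k = 1 then (0 : ℝ) else ((P.c k : ℝ) + 1)))) *
          (1 - headProduct X n) ^ (-r (n + 1)))) := by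
  have hL : L n P = ∫⁻ X in (Set.pi Set.univ fun _ : Fin n => Ioo (0 : ℝ) 1), ENNReal.ofReal (integrandL n P X) := by
    unfold L
    rw [← setLIntegral_congr (openCube_ae_eq_unitCube n)]
  refine ⟨?_, fun h0 => ?_⟩
  · rw [hL]
    refine setLIntegral_mono' (measurableSet_openCube n) fun X hX' => ENNReal.ofReal_le_ofReal ?_
    have hX := mem_openCube_iff.1 hX'
    rw [integrandL_eq_rpow_prod hn P hX]
    exact prod_le_psi _ _ _ r hr hn hX
  · rw [hL]
    refine setLIntegral_congr_fun (measurableSet_openCube n) fun X hX' => ?_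
    have hX := mem_openCube_iff.1 hX'
    rw [integrandL_eq_rpow_prod hn P hX, h0, neg_zero, Real.rpow_zero, mul_one]

end LFinite

end Literature.NumberTheory.Irrationality.Fischler2002

end
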